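/- Copyright: the b2b-balaban cell (near-miss cell 7), T⁴-continuum fan-out; row NE7b ROUND-2 swarm, seat
t4-ne7b-formalise-leaf-06 (gen 7) (road W-RP, sub-row «W-LAB», file 7: THE READER WITNESS — the W road's witness with
per cutoff ONE cube reader per run; W7's `ChessboardGibbsWitness` and headline BY NAME; INTENT journal l.17482).
Released under the licence of the surrounding project. -/
import Summits.QuantumFields.BalabanUV.T4Continuum.Support.HistoryChessboardGibbs
import Summits.QuantumFields.BalabanUV.T4Continuum.Support.HistoryChessboardLabelsPattern

/-!
# Road W-RP, sub-row «W-LAB», file 7: THE READER WITNESS and the headline over it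

Summits-side support leaf of the T⁴-continuum cell (rung (B)+1 on a FINITE torus only; NOT infinite volume, NOT the
mass gap, NOT the Clay statement; NOT a proof of the spine estimate NE7b).  Row NE7b, road **W-RP** (R-OWNER-23-2 ∕
R-OWNER-23-8), sub-row «W-LAB», file 7 = the apex-level packaging of file 6: W7 file 2's `ChessboardGibbsWitness`
(leaf-03 g5, `HistoryChessboardGibbs`) with the term families, bad classes, term ∕ cell events and weights FIXED to the
CANONICAL PATTERN DATA of one cube reader per run and cutoff (file 6 `HistoryChessboardLabelsPattern`:
`GibbsReaderPattern`, `.side os`; W7 v1.1's `weight`).  [folklore] bookkeeping over TREE theorems; ONE hypothesis SHAPE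
`structure ChessboardReaderWitness … : Type` (consumed under `Nonempty`, as W6's∕W7's witnesses), TWO DATA defs
(`patternOf`, `patternEv`: the pattern map of a reader and its fibres) and ONE DATA def `toGibbsWitness`; no `[cite:]`
tag, no `Prop`-valued FACT minted (c1), no constant (c2∕c6), no exit ∕ socket ∕ `HistoryConstants` ∕ END ∕ apex file
touched (c3); nothing of W6 ∕ W7 ∕ files 1–6 restated.

WHAT.  `patternOf hm₁ K f` (`ω ↦ (c ↦ f (towerTranslate K (cubeCorner h c) ω))`), `patternEv hm₁ K f` (its fibres);
**`structure ChessboardReaderWitness D g₀ os Λ m₁ : Type`** = `ChessboardGibbsWitness` with `T := fun _ => univ`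
(patterns `BlockIdx 4 (cubeCount F m₁) → Λ`), `Bad := fun _ => badPatterns P`, `ev ∕ ev' :=` the pattern fibres of
the readers `f K` ∕ `f' K`, `E ∕ E' :=` their label events, `A ∕ A' :=` W7's `weight` of the pattern fibres, and
`sideA ∕ sideB` REPLACED by **`patA : ∀ K ≥ K₀, GibbsReaderPattern D g₀ hm₁ K P (f K) (r K)`**,
**`patB : ∀ K ≥ K₀, GibbsReaderPattern D g₀ hm₁ (K+1) P (f' K) (r' K)`** (FOUR clauses each); NE7c `shell` and NE7 `budget`
ON THE DEFINED PATTERN WEIGHTS, rates as in W7; **`ChessboardReaderWitness.toGibbsWitness`** (every field copied or fixed;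
`sideA K hK := (patA K hK).side os`); the ENDs over W7 BY NAME: `stringHybridNE7_of_readerWitness`,
`forSmallCouplings_stringwise_of_readerWitness` (PIN-FREE), `hybridNE7Under_of_readerWitness_fsc`,
`targets_of_readerWitness_fsc`, **`continuumYM4Torus_of_readerWitness_fsc`**.

HONEST READING (R-OWNER-23-8 wording for road W-RP; the owner rules on headlines, R-OWNER-23-14).  «Road W-RP (the
printed, centred 4-d averaging prescription [B12] (0.3)–(0.4)) on the data's own Gibbs cube towers, READ BY CUBE READERS:
`ContinuumYM4Torus D ⇐ (B) ∧ BetaPertHyp ∧ [∀ small-coupling tuned run ∀ string: a ChessboardReaderWitness]`, where the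
witness DISPLAYS — as hypothesis shapes, none in print, none a theorem of the tree — per run and cutoff ONE reader `f` of
the reference cube column with FOUR clauses (`read_meas`: every fibre an event of `towerBox G K (L^{m₁}) K`;
`read_sym`: pointwise reflection symmetry per axis; `univ_le`: (U1)×(G2) in ratio currency, (B)'s content as a READING;
`r ≥ 0`), and per string NE7c's `ShellWeightBound` and NE7's `ReindexedBudget` ON THE DEFINED PATTERN WEIGHTS
`weight D g₀ os K (patternEv …)` with four summable rates, summable per-cube rates, source radius, volume factor,
threshold; (EXT) proper is now the sentence «Bałaban's 𝐑-operation expansion terms at cutoff `K` ARE the pattern events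
of THIS reader with `Zrun ·` source-dressed Gibbs-tower masses as weights» (in print the terms carry 𝐑-operations and
analytic continuations, not bare characteristic functions); `prob`, the RP five, `Even`, `Z_pos`, `obs_*`, E1∕E2,
`ev_meas`∕`ev_cover`∕`ev_disj`∕`bad_disj`∕`bad_sub`∕`E_meas`∕`loc`∕`sym`∕`repr`∕`bad_subset`∕`range`∕`term_meas`∕`bad_lab`
are THEOREMS or DEFINITIONS by name; the identifications «`blockAvg ℰ` is (0.4)» and «the run's state at cutoff `K` is
the Gibbs tower law» remain READINGS (T-class).  NOTHING of the nine discharged; spine 0∕9 UNCHANGED; NE7b NOT proved;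
finite T⁴ only.»  HONEST DEPENDENCY (cell): continuum YM on T⁴ ⇐ BetaPertH ∧ nine spine estimates (0/9 proved);
BetaPertH ⇐ (D1) ∧ (D4) ∧ CAP+tail; G-an2-4 gates asym, D1 and NE2/3/4.  This file changes none of it.
-/

open Finset MeasureTheory
open Literature.Barriers.CriticalPhenomena.NonGibbs
open Literature.MathematicalPhysics.QuantumFieldTheory.Balaban1983to89
open Literature.MathematicalPhysics.QuantumFieldTheory.Balaban1983to89.Missing
open Literature.MathematicalPhysics.QuantumFieldTheory.Balaban1983to89.T4Continuum
open Literature.MathematicalPhysics.QuantumFieldTheory.Balaban1983to89.T4IndicatorShell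
open Literature.MathematicalPhysics.QuantumFieldTheory.Balaban1983to89.T4MatchingAssembly
open Literature.MathematicalPhysics.QuantumFieldTheory.Balaban1983to89.T4MatchingClosure
open Summit.QuantumFields.BalabanUV.T4Continuum
open HistoryRPTowerLaw HistoryRPTowerCuts HistoryRPTowerTemplates HistoryRPTowerUniform HistoryChessboardEventsCubes
open HistoryChessboardEventsTemplates HistoryChessboardTowerRepr HistoryChessboardApex HistoryChessboardHeadline
open HistoryChessboardGibbsSide HistoryChessboardGibbs HistoryChessboardLabelsPattern

namespace Summit.QuantumFields.BalabanUV.T4Continuum.HistoryChessboardReaderWitness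

noncomputable section

/-! ## §1 The pattern map of a cube reader and its fibres -/

section Pattern

variable {F : T4Family} {G : Type} {Λ : Type} {m₁ : ℕ}

/-- **THE PATTERN MAP OF A CUBE READER** at cutoff `K` (cubes of side `L^{m₁}`): the state `ω` is sent to the labelling
`c ↦ f (towerTranslate K (cubeCorner h c) ω)` of the cube torus (file 6's canonical term label). -/
def patternOf (hm₁ : m₁ ≤ F.m) (K : ℕ) (f : Tower (F.P K) G K → Λ) :
    Tower (F.P K) G K → (BlockIdx 4 (cubeCount F m₁) → Λ) :=
  fun ω c => f (towerTranslate K (cubeCorner (sitesPerDir_top_eq F hm₁ K) c) ω)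

/-- **THE PATTERN EVENTS** (the fibres of the pattern map = file 6's canonical term events). -/
def patternEv (hm₁ : m₁ ≤ F.m) (K : ℕ) (f : Tower (F.P K) G K → Λ) :
    (BlockIdx 4 (cubeCount F m₁) → Λ) → Set (Tower (F.P K) G K) :=
  fun p => patternOf hm₁ K f ⁻¹' {p}

/-- `patternOf` evaluated. [folklore] -/
@[simp] theorem patternOf_apply (hm₁ : m₁ ≤ F.m) (K : ℕ) (f : Tower (F.P K) G K → Λ) (ω : Tower (F.P K) G K)
    (c : BlockIdx 4 (cubeCount F m₁)) :
    patternOf hm₁ K f ω c = f (towerTranslate K (cubeCorner (sitesPerDir_top_eq F hm₁ K) c) ω) := rfl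

/-- `patternEv` unfolded. [folklore] -/
theorem patternEv_eq (hm₁ : m₁ ≤ F.m) (K : ℕ) (f : Tower (F.P K) G K → Λ) (p : BlockIdx 4 (cubeCount F m₁) → Λ) :
    patternEv hm₁ K f p = patternOf hm₁ K f ⁻¹' {p} := rfl

end Pattern

/-! ## §2 The reader witness ⇒ W7's Gibbs witness -/

section Witness

variable {F : T4Family} {G : Type} [GaugeGroup G] [MeasurableSpace G] [HaarData G]

/-- **A READER WITNESS ON THE DATA'S OWN GIBBS CUBE TOWERS for the tuned run `g₀` and the loop string `os`**
(HYPOTHESIS SHAPE — data + displayed binders, NOTHING asserted): W7's `ChessboardGibbsWitness` with, per cutoff, ONE cube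
READER per run (`f K` on the `K`-tower, `f' K` on the `(K+1)`-tower) carrying file 6's FOUR clauses, the terms being the
readers' PATTERNS (`univ`), the bad classes the bad patterns, the term events the pattern fibres, the weights W7's
`weight` of them; NE7c's shell bound and NE7's core budget are displayed ON THESE DEFINED WEIGHTS. [folklore] -/
structure ChessboardReaderWitness (D : FiniteEpsData F G) (g₀ : ℕ → ℝ) (os : List (ULoop F)) (Λ : Type)
    [Fintype Λ] [DecidableEq Λ] (m₁ : ℕ) : Type where
  /-- the cubes have side `L^{m₁}`, `m₁ ≤ m` -/
  hm₁ : m₁ ≤ F.m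
  /-- the source radius -/
  l₀ : ℝ
  /-- the volume factor of the matching remainders -/
  vol : ℝ
  /-- the source radius is positive -/
  l₀_pos : 0 < l₀
  /-- the volume factor is positive -/
  vol_pos : 0 < vol
  /-- the threshold in the number of steps -/
  K₀ : ℕ
  /-- the bad labels -/
  P : Finset Λ
  /-- run A: the cube reader at cutoff `K` (on the `K`-tower) -/
  f : ∀ K, Tower (F.P K) G K → Λ
  /-- run B: the cube reader at cutoff `K` (on the `(K+1)`-tower) -/
  f' : ∀ K, Tower (F.P (K + 1)) G (K + 1) → Λ
  /-- run A: per-cube rates -/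
  r : ℕ → ℝ
  /-- run B: per-cube rates -/
  r' : ℕ → ℝ
  /-- run A's readers satisfy file 6's four clauses from the threshold on -/
  patA : ∀ K, K₀ ≤ K → GibbsReaderPattern D g₀ hm₁ K P (f K) (r K)
  /-- run B's readers likewise (the `(K+1)`-step run) -/
  patB : ∀ K, K₀ ≤ K → GibbsReaderPattern D g₀ hm₁ (K + 1) P (f' K) (r' K)
  /-- run A's per-cube rates are summable over the cutoff -/
  sum_r : Summable r
  /-- run B's per-cube rates are summable over the cutoff -/
  sum_r' : Summable r'
  /-- the two runs' shell parts (NE7c) -/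
  (shA shB : ℕ → ℝ → (BlockIdx 4 (cubeCount F m₁) → Λ) → ℝ)
  /-- NE7 core budget data (`ReindexedBudget`) -/
  (Cc Rr CcRec RrRec : ℕ → ℝ → (BlockIdx 4 (cubeCount F m₁) → Λ) → ℝ)
  /-- NE7 core budget rates; `rr u s s₂` summable -/
  (ν u s₂ c₀ rr s : ℕ → ℝ)
  /-- NE7c's shell weight budget -/
  Wsh : ℕ → ℝ
  /-- NE7c: the indicator shells' relative weight bound, ON THE DEFINED PATTERN WEIGHTS -/
  shell : ShellWeightBound l₀ (fun _ => (Finset.univ : Finset (BlockIdx 4 (cubeCount F m₁) → Λ)))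
    (fun K => weight D g₀ os K (patternEv hm₁ K (f K))) (fun K => weight D g₀ os (K + 1) (patternEv hm₁ (K + 1) (f' K)))
    shA shB Wsh
  /-- NE7: the core budget on the hybrid cores over the bad patterns, ON THE DEFINED PATTERN WEIGHTS -/
  budget : ReindexedBudget l₀ vol (fun _ => (Finset.univ : Finset (BlockIdx 4 (cubeCount F m₁) → Λ)))
    (fun K t p => weight D g₀ os K (patternEv hm₁ K (f K)) t p - shA K t p)
    (fun K t p => weight D g₀ os (K + 1) (patternEv hm₁ (K + 1) (f' K)) t p - shB K t p)
    (fun _ _ => badPatterns P) Cc Rr CcRec RrRec ν u s₂ c₀ rr s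
  /-- summable rates -/
  sum_rr : Summable rr
  /-- summable rates -/
  sum_u : Summable u
  /-- summable rates -/
  sum_s : Summable s
  /-- summable rates -/
  sum_s₂ : Summable s₂

variable {D : FiniteEpsData F G} {g₀ : ℕ → ℝ} {os : List (ULoop F)} {Λ : Type} [Fintype Λ] [DecidableEq Λ] {m₁ : ℕ}

/-- **THE READER WITNESS IS A GIBBS WITNESS** (W7 file 2's structure ITSELF, index type the PATTERNS): threshold,
radii, rates, shell ∕ budget data copied; `T := univ`, `Bad := badPatterns P`, `ev ∕ ev' :=` pattern fibres, `E ∕ E' :=`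
label events, `A ∕ A' :=` the defined weights; **`sideA K hK := (patA K hK).side os`**, `sideB` likewise (file 6). -/
def ChessboardReaderWitness.toGibbsWitness (X : ChessboardReaderWitness D g₀ os Λ m₁) :
    ChessboardGibbsWitness D g₀ os (BlockIdx 4 (cubeCount F m₁) → Λ) Λ m₁ where
  hm₁ := X.hm₁
  l₀ := X.l₀
  vol := X.vol
  l₀_pos := X.l₀_pos
  vol_pos := X.vol_pos
  K₀ := X.K₀
  P := X.P
  T := fun _ => Finset.univ
  A := fun K => weight D g₀ os K (patternEv X.hm₁ K (X.f K))
  A' := fun K => weight D g₀ os (K + 1) (patternEv X.hm₁ (K + 1) (X.f' K))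
  shA := X.shA
  shB := X.shB
  Bad := fun _ => badPatterns X.P
  ev := fun K => patternEv X.hm₁ K (X.f K)
  E := fun K l c => {ω | patternOf X.hm₁ K (X.f K) ω c = l}
  r := X.r
  ev' := fun K => patternEv X.hm₁ (K + 1) (X.f' K)
  E' := fun K l c => {ω | patternOf X.hm₁ (K + 1) (X.f' K) ω c = l}
  r' := X.r'
  sideA := fun K hK => (X.patA K hK).side os
  sideB := fun K hK => (X.patB K hK).side os
  sum_r := X.sum_r
  sum_r' := X.sum_r'
  Cc := X.Cc
  Rr := X.Rr
  CcRec := X.CcRec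
  RrRec := X.RrRec
  ν := X.ν
  u := X.u
  s₂ := X.s₂
  c₀ := X.c₀
  rr := X.rr
  s := X.s
  Wsh := X.Wsh
  shell := X.shell
  budget := X.budget
  sum_rr := X.sum_rr
  sum_u := X.sum_u
  sum_s := X.sum_s
  sum_s₂ := X.sum_s₂

/-- The junction keeps the threshold, the source radius and the volume factor (definitionally). [folklore] -/
example (X : ChessboardReaderWitness D g₀ os Λ m₁) :
    X.toGibbsWitness.K₀ = X.K₀ ∧ X.toGibbsWitness.l₀ = X.l₀ ∧ X.toGibbsWitness.vol = X.vol :=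
  ⟨rfl, rfl, rfl⟩

end Witness

/-! ## §3 The ENDs over W7 (hence W6), by name -/

section Under

variable {F : T4Family} {n : ℕ} [NeZero n] {ℰ : LoopAverage (Matrix.specialUnitaryGroup (Fin n) ℂ)}

/-- The prefixed reader-witness hypothesis gives W7's prefixed Gibbs-witness hypothesis (`ForSmallCouplings.mono` with
`toGibbsWitness`). [folklore] -/
theorem forSmallCouplings_gibbsWitness_of_readerWitness
    (D : FiniteEpsData F (Matrix.specialUnitaryGroup (Fin n) ℂ))
    (hData : T4ContinuumYM4Torus.ForSmallCouplings D fun g₀ => ∀ os : List (ULoop F),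
      ∃ (Λ : Type) (_ : Fintype Λ) (_ : DecidableEq Λ) (m₁ : ℕ), Nonempty (ChessboardReaderWitness D g₀ os Λ m₁)) :
    T4ContinuumYM4Torus.ForSmallCouplings D fun g₀ => ∀ os : List (ULoop F),
      ∃ (ι Λ : Type) (_ : DecidableEq ι) (m₁ : ℕ), Nonempty (ChessboardGibbsWitness D g₀ os ι Λ m₁) :=
  hData.mono fun g₀ h os => by
    obtain ⟨Λ, _, _, m₁, ⟨X⟩⟩ := h os
    exact ⟨BlockIdx 4 (cubeCount F m₁) → Λ, Λ, inferInstance, m₁, ⟨X.toGibbsWitness⟩⟩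

/-- **ONE STRING**: a reader witness ⇒ the apex lineage's per-string datum `StringHybridNE7 (D.scheme g₀) os l₀ vol K`,
some `K ≥ K₀` (W7's `stringHybridNE7_of_gibbsWitness` on `toGibbsWitness`).  CONDITIONAL; NE7b NOT proved. [folklore] -/
theorem stringHybridNE7_of_readerWitness {D : FiniteEpsData F (Matrix.specialUnitaryGroup (Fin n) ℂ)}
    (hBA : D.IsBlockAveraged ℰ) (hE : ℰ.MeasurableE) {g₀ : ℕ → ℝ} {os : List (ULoop F)} {Λ : Type} [Fintype Λ]
    [DecidableEq Λ] {m₁ : ℕ} (X : ChessboardReaderWitness D g₀ os Λ m₁) :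
    ∃ K, X.K₀ ≤ K ∧ StringHybridNE7 (D.scheme g₀) os X.l₀ X.vol K :=
  stringHybridNE7_of_gibbsWitness hBA hE X.toGibbsWitness

/-- **PIN-FREE**: if for all SMALL-coupling tuned runs and every loop string a reader witness is displayed, then for the
same runs every string carries the apex lineage's hybrid-NE7 datum; NEITHER `(B)` NOR `BetaPertHyp` is an input
(W7's `forSmallCouplings_stringwise_of_gibbsWitness`).  CONDITIONAL; NE7b NOT proved. [folklore] -/
theorem forSmallCouplings_stringwise_of_readerWitness (D : FiniteEpsData F (Matrix.specialUnitaryGroup (Fin n) ℂ))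
    (hBA : D.IsBlockAveraged ℰ) (hE : ℰ.MeasurableE)
    (hData : T4ContinuumYM4Torus.ForSmallCouplings D fun g₀ => ∀ os : List (ULoop F),
      ∃ (Λ : Type) (_ : Fintype Λ) (_ : DecidableEq Λ) (m₁ : ℕ), Nonempty (ChessboardReaderWitness D g₀ os Λ m₁)) :
    T4ContinuumYM4Torus.ForSmallCouplings D fun g₀ => T4ApexHybrid.StringwiseHybridNE7 (D.scheme g₀) :=
  forSmallCouplings_stringwise_of_gibbsWitness D hBA hE (forSmallCouplings_gibbsWitness_of_readerWitness D hData)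

/-- **`HybridNE7Under D (BetaPertHyp D.βfun)` FROM THE PREFIXED READER WITNESSES** (W7's
`hybridNE7Under_of_gibbsWitness_fsc`).  CONDITIONAL; NE7b NOT proved. [folklore] -/
theorem hybridNE7Under_of_readerWitness_fsc (D : FiniteEpsData F (Matrix.specialUnitaryGroup (Fin n) ℂ))
    (hBA : D.IsBlockAveraged ℰ) (hE : ℰ.MeasurableE)
    (hData : T4ContinuumYM4Torus.ForSmallCouplings D fun g₀ => ∀ os : List (ULoop F),
      ∃ (Λ : Type) (_ : Fintype Λ) (_ : DecidableEq Λ) (m₁ : ℕ), Nonempty (ChessboardReaderWitness D g₀ os Λ m₁)) :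
    T4ApexHybrid.HybridNE7Under D (BetaPertHyp D.βfun) :=
  hybridNE7Under_of_gibbsWitness_fsc D hBA hE (forSmallCouplings_gibbsWitness_of_readerWitness D hData)

/-- **THE FOUR T⁴ TARGETS FROM THE READER WITNESSES** (W7's `targets_of_gibbsWitness_fsc`): NO PIN IS AN INPUT.
CONDITIONAL; NE7b NOT proved. [folklore] -/
theorem targets_of_readerWitness_fsc (D : FiniteEpsData F (Matrix.specialUnitaryGroup (Fin n) ℂ))
    (hBA : D.IsBlockAveraged ℰ) (hE : ℰ.MeasurableE)
    (hData : T4ContinuumYM4Torus.ForSmallCouplings D fun g₀ => ∀ os : List (ULoop F),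
      ∃ (Λ : Type) (_ : Fintype Λ) (_ : DecidableEq Λ) (m₁ : ℕ), Nonempty (ChessboardReaderWitness D g₀ os Λ m₁)) :
    D.ym4_torus_continuum_limit_exists ∧ D.ym4_torus_continuum_limit_unique ∧
      D.limit_reflectionPositive ∧ D.limit_torusCovariant :=
  targets_of_gibbsWitness_fsc D hBA hE (forSmallCouplings_gibbsWitness_of_readerWitness D hData)

/-- **THE HEADLINE PREDICATE FROM READER WITNESSES**: `ContinuumYM4Torus D` for (0.4)-block-averaged `SU(n)` data with a
measurable small-loop average, GIVEN the two pins `(B)` and `BetaPertHyp D.βfun` BY NAME (consumed only inside W6's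
headline, at `continuumYM4Torus_of_targets`) and, for all small-coupling tuned runs and every loop string, a
`ChessboardReaderWitness` — per run and cutoff ONE cube reader with FOUR clauses, per string NE7c ∕ NE7 on the DEFINED
pattern weights + rates (W7's `continuumYM4Torus_of_gibbsWitness_fsc` BY NAME).  NOTHING of the nine discharged; NE7b NOT
proved; 0∕9; finite T⁴ only. [folklore] -/
theorem continuumYM4Torus_of_readerWitness_fsc (D : FiniteEpsData F (Matrix.specialUnitaryGroup (Fin n) ℂ))
    (hBA : D.IsBlockAveraged ℰ) (hE : ℰ.MeasurableE) (hB : B16.EndStatementBPrinted D.C) (hβ : BetaPertHyp D.βfun)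
    (hData : T4ContinuumYM4Torus.ForSmallCouplings D fun g₀ => ∀ os : List (ULoop F),
      ∃ (Λ : Type) (_ : Fintype Λ) (_ : DecidableEq Λ) (m₁ : ℕ), Nonempty (ChessboardReaderWitness D g₀ os Λ m₁)) :
    T4ContinuumYM4Torus.ContinuumYM4Torus D :=
  continuumYM4Torus_of_gibbsWitness_fsc D hBA hE hB hβ (forSmallCouplings_gibbsWitness_of_readerWitness D hData)

end Under

end

end Summit.QuantumFields.BalabanUV.T4Continuum.HistoryChessboardReaderWitness
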